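import Mathlib
import Literature.MathematicalPhysics.QuantumFieldTheory.KanekoUeda2010.DominantConeNormalForm
import Literature.MathematicalPhysics.QuantumFieldTheory.Volkov2017.DominatedToyDivergence
import HarnessLib

/-!
# Kaneko–Ueda 2010 §3 / Borinsky 2020 §2.3: on a dominated cone chart the sector integral CONVERGES IFF every exponent is positive — the DIVERGENCE half («m_k^{(s)} ≤ 0 for some sector … the associated integral I_s is divergent») for a SIGNED numerator, with BND 5.8.1's non-cancellation remark (the face numerator of a homogeneous P is not the zero polynomial when the generators span modulo 𝟙) — PROVED

independent recomputation; certified where stated, statistical where stated; no new-physics claim.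

CITATION HEADER (venture `QEDPrecision`, cell `qed-hepp` (HOME `run/shared/lean/pub/qed-hepp/`), literature seat `qed-hepp-lit` gen 7;
VALUE-FREE: (non-)integrability statements about ABSTRACT multivariate polynomials under a monomial change of variables — no Feynman
graph, no sector table, no Monte-Carlo value, nothing per word or per Set-V family). Companion of `DominantConeNormalForm.lean` (same
folder, p402490: KU's normal form `eval_coneChart_eq_monom_mul` and the BOUNDEDNESS half `abs_eval_div_prod_pow_mul_monom_le` — «E ≥ 0 at
every generator ⇒ bounded by a stated constant»). Serves the theory seat's `HOME/theory/BOUNDEDNESS.md` §5.8.1 «LEMMA (leaf normal form) …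
Remark: for every l, P̃|_{t_l=0} is NOT the zero polynomial — the monomials of P attaining val_{v_l}(P) map injectively to t-exponent
vectors (v_1..v_M and 1_E span ℝ^N; P is homogeneous), so no cancellation can occur among them. HENCE, with all three equivalent: f·J
bounded on the cube ⟺ E ≥ 0 (all l) ⟺ f·J ∈ L¹(cube) [if E_l ≤ −1: |h| ≥ ε on a box {t_l ≤ τ} × B around a point of {t_l = 0} where h ≠ 0,
and ∫₀^τ t^{E_l} dt = ∞; if E ≥ 0: bounded]» and its sorried `Sketch.lean` shape `integrable_iff_rayCertificate_shape` (the per-leaf half):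
this file PROVES «f·J ∈ L¹((0,1]^M) ⟺ E_l ≥ 0 for all l» for the abstract leaf integrand (`integrableOn_leafIntegrand_iff_of_span`). Cell
sheet `HOME/lit/SOURCES.md` §7/§12.D.

Sources. [KanekoUeda2010] T. Kaneko, T. Ueda, Comput. Phys. Commun. 181 (2010) 1352 = arXiv:0908.2897, §3 eq. (geo:glz) and after
[chunk p7:L63–L110], VERBATIM: "t_j = e^{−y_j} = e^{−(Vu)_j} = Π_k z_k^{(v_k)_j} … Since (c−b, y) ≥ 0 for all y ∈ Δ_b^P and (c−b) ∈ ℤ^{N−1},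
(c−b, v_j) is non-negative integer. Thus the sub-expressions in the brackets of Eq. (geo:glz) are polynomials of z." (the normal form; KU's
numerator is a monomial and they print nothing about divergence). [Borinsky2020] M. Borinsky, Ann. Inst. Henri Poincaré D 10 (2023) 635 =
arXiv:2008.12310, §2.3 [chunk p7:L8–L23], VERBATIM: "I = Σ_{s∈S} I_s, I_s = C_s ∫_{[0,1]^{n−1}} x^{m^{(s)}} Π_i p_{s,i}^{ν_i}(x)/Π_j q_{s,j}^{ρ_j}(x)
Π_k dx_k/x_k, such that the auxiliary polynomials p_{s,i}(x) and q_{s,j}(x) do not vanish inside the integration domain [0,1]^{n−1} (at least as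
long as all the coefficients of the initial denominator polynomials b_j are positive …). If all components of the vector m^{(s)} are positive,
i.e. m^{(s)}_k > 0 for all k, a simple reparametrization … produces an integral with a bounded integrand … A violation of the condition 𝒜 ⊂ ℬ in
Theorem 3 corresponds to a component of m^{(s)} … being non-positive, i.e. m^{(s)}_k ≤ 0 for some sector s ∈ S. Hence, if we assume that
the polynomials p_{s,i}, q_{s,i} are non-vanishing on the integration domain, then the associated integral I_s is divergent."

TYPING (the companion's: `coneChart v z j = Π_k z_k^{v k j}`, `ipair (v l) c = (c, v_l) ∈ ℕ`, `minPair P (v l) = val_{v_l}(P)`; `K` indexes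
the denominator factors `F_k` with powers `a_k ∈ ℕ` and chosen support monomials `b_k`, DOMINANT on the cone: `(b_k, v_l) ≤ (c, v_l)` for all
`c ∈ supp F_k` and all `l`; `w : Fin M → ℕ` is the extra monomial weight of the measure/Jacobian — in BND's leaf chart `w_l = |v_l| − 1`, so
that BND's `E_l = Deg(v_l) − 1 = val_{v_l}(P) + w_l − Σ_k a_k (b_k, v_l)` and Borinsky's `m_k = E_k + 1`). The LEAF INTEGRAND is
`leafIntegrand P F a v w z = |P(t(z))| / Π_k F_k(t(z))^{a_k} · Π_l z_l^{w_l}` on the half-open cube `unitIoc M = (0,1]^M` with Lebesgue measure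
(`volume`; the cube has measure 1). The REDUCED NUMERATOR is `reducedEval P v z = Σ_c p_c Π_l z_l^{(c,v_l) − val_l}` (BND's P̃; KU's bracket),
the FACE POLYNOMIAL at `l₀` is `facePoly P v l₀ = Σ_{c : (c,v_{l₀}) = val_{l₀}} p_c X^{e(c)}`, `e(c)_l = (c,v_l) − val_l` (`redExp`) — BND's
`P̃|_{t_{l₀} = 0}` — with `eval_facePoly : facePoly(z) = P̃(z[l₀ ↦ 0])`. "Generators span ℝ^N together with 𝟙" is the hypothesis
`hspan : ∀ d, (∀ l, Σ_j v_{lj} d_j = 0) → Σ_j d_j = 0 → d = 0`; "P homogeneous" is Mathlib's `MvPolynomial.IsHomogeneous P n`.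

PROVED (0 named facts, D-0026; Mathlib + the companion + the tree's box lemma `Volkov2017.not_integrable_of_prod_rpow_le_on_box` and
`MvPolynomial.funext_set`):
* `eval_coneChart_eq_prod_pow_mul_reducedEval` — `P(t(z)) = z^{val}·P̃(z)`; `continuous_reducedEval`; `eval_coneChart_le_sum_coeff_mul_prod_pow`
  and `prod_eval_coneChart_pow_le` — dominated positive denominators are bounded ABOVE by their monomial: `Π_k F_k(t(z))^{a_k} ≤ C_F·Π_l z_l^{S_l}`,
  `C_F = Π_k F_k(1)^{a_k}`, `S_l = Σ_k a_k (b_k, v_l)`, on the closed cube;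
* **`integrableOn_leafIntegrand_of_exponent_le`** — SUFFICIENCY («m_k > 0 for all k ⇒ bounded integrand»): `S_l ≤ val_l + w_l ∀ l ⇒`
  the leaf integrand is integrable on `(0,1]^M` (bounded by the companion's stated constant on a set of measure 1; no domination needed);
* **`not_integrableOn_leafIntegrand_of_exponent_gt`** — NECESSITY, WITNESS FORM: dominance, ONE generator `l₀` with `val_{l₀} + w_{l₀} + 1 ≤ S_{l₀}`
  (E_{l₀} ≤ −1, i.e. m ≤ 0) and ONE point `zs ∈ (0,1)^M` with `P̃(zs[l₀ ↦ 0]) ≠ 0` ⇒ NOT integrable on `(0,1]^M` (proof = BND's bracket: continuity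
  of P̃ gives |P̃| ≥ |P̃(face point)|/2 on a box around the face point, the denominators are ≤ C_F z^S, so the integrand dominates
  `κ·z_{l₀}^{E_{l₀}}` ≥ `κ·z_{l₀}^{−1}` on a box reaching the face, and the box lemma gives `∫ = ∞`). Borinsky's printed hypothesis «p_{s,i}
  non-vanishing on the integration domain» trivially supplies the witness;
* `injOn_ipair_of_span` (span + homogeneity ⇒ `c ↦ ((c,v_l))_l` injective on `supp P`), `facePoly_ne_zero` (⇒ the face polynomial has the
  non-zero coefficient `p_{c₀}` at `e(c₀)` for a monomial `c₀` attaining `val_{l₀}`), `exists_reducedEval_face_ne_zero` (a non-zero real polynomial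
  does not vanish on `(0,1)^M` ⇒ a witness exists) — BND 5.8.1's REMARK;
* **`not_integrableOn_leafIntegrand_of_exponent_gt_of_span`** — NECESSITY, STRUCTURAL FORM: `P ≠ 0` homogeneous, `hspan`, dominance, one `E_{l₀} ≤ −1`
  ⇒ not integrable; **`integrableOn_leafIntegrand_iff_of_span`** — THE CRITERION: integrable on `(0,1]^M ⟺ ∀ l, S_l ≤ val_l + w_l` (E ≥ 0).
NOT typed: the Jacobian constant `|det V|` and the assembly of the leaves into the simplex integral (BND 5.8.2 (a) ⟺ (c): `Borinsky2020.
GeometricSectorDecomposition` / `ConeIntegral` carry the cone-integral side), rational (non-lattice) generators, non-integer powers `a_k`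
(Borinsky's ρ_j ∈ ℝ_{>0}; here `a_k ∈ ℕ` as in the companion and in BND — TODO(general form): real `a_k` with `Real.rpow`, same proofs), the
boundedness-vs-integrability distinction for non-integer E (here all exponents are integers, so «E ≥ 0» and «E > −1» coincide, BND 5.8.2 (5)).
-/

noncomputable section

open MvPolynomial Finset Real MeasureTheory Set

namespace Literature.MathematicalPhysics.QuantumFieldTheory.KanekoUeda2010

open Borinsky2020

variable {N M : ℕ}

/-! ### The reduced numerator `P̃(z) = z^{−val(P)}·P(t(z))` -/

/-- `P̃(z) := Σ_c p_c · Π_l z_l^{(c, v_l) − val_{v_l}(P)}` — the numerator with its cone-wise valuation factored out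
(KU's bracket of eq. (geo:glz) when `P` has a dominant monomial; BND 5.8.1's `P̃ := t^{−val(P)}·P(x(t))`).
[cite: KanekoUeda2010, §3 eq. (geo:glz) (chunk p7:L63–L110)] -/
def reducedEval (p : MvPolynomial (Fin N) ℝ) (v : Fin M → Fin N → ℕ) (z : Fin M → ℝ) : ℝ :=
  ∑ c ∈ p.support, p.coeff c * ∏ l, z l ^ (ipair (v l) c - minPair p (v l))

/-- `P(t(z)) = (Π_l z_l^{val_{v_l}(P)}) · P̃(z)` — every monomial carries at least the minimal exponent in each `z_l`.
[cite: KanekoUeda2010, §3 eq. (geo:glz) and «(b, u) = min{(c, u) | c ∈ Z^P}» (chunk p6:L50–L56, p7:L63–L110)] -/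
theorem eval_coneChart_eq_prod_pow_mul_reducedEval (p : MvPolynomial (Fin N) ℝ) (v : Fin M → Fin N → ℕ) (z : Fin M → ℝ) :
    eval (coneChart v z) p = (∏ l, z l ^ minPair p (v l)) * reducedEval p v z := by
  classical
  rw [eval_eq_sum_coeff_mul_monom, reducedEval, Finset.mul_sum]
  refine Finset.sum_congr rfl fun c hc => ?_
  rw [monom_coneChart, mul_left_comm, ← Finset.prod_mul_distrib]
  congr 1
  exact Finset.prod_congr rfl fun l _ => by rw [← pow_add, Nat.add_sub_cancel' (minPair_le hc)]

/-- `P̃` is a polynomial function of `z`, hence continuous (BND 5.8.1: «h is continuous … on [0,1]^M»).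
[cite: KanekoUeda2010, §3 after eq. (geo:glz): «the sub-expressions in the brackets … are polynomials of z» (chunk p7:L100–L110)] -/
theorem continuous_reducedEval (p : MvPolynomial (Fin N) ℝ) (v : Fin M → Fin N → ℕ) : Continuous (reducedEval p v) :=
  continuous_finsetSum _ fun _ _ => continuous_const.mul (continuous_finsetProd _ fun l _ => (continuous_apply l).pow _)

/-- The chart is continuous in `z`. [cite: KanekoUeda2010, §3 (chunk p7:L95–L99)] -/
theorem continuous_coneChart (v : Fin M → Fin N → ℕ) : Continuous (coneChart v) :=
  continuous_pi fun _ => continuous_finsetProd _ fun k _ => (continuous_apply k).pow _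

/-- `z ↦ P(t(z))` is continuous. [cite: KanekoUeda2010, §3 (chunk p7:L95–L110)] -/
theorem continuous_eval_coneChart (p : MvPolynomial (Fin N) ℝ) (v : Fin M → Fin N → ℕ) :
    Continuous fun z => eval (coneChart v z) p :=
  (MvPolynomial.continuous_eval p).comp (continuous_coneChart v)

/-! ### Upper bound of a dominated positive-coefficient polynomial by its dominant monomial -/

/-- On a cone where `b ∈ supp F` is dominant and `F` has non-negative coefficients: `F(t(z)) ≤ (Σ_c f_c) · Π_l z_l^{(b, v_l)}` on the
closed cube — the printed «C_a z^{b_a}(1 + H_a(z))» with `1 + H_a ≤ F(1,…,1)/C_a`.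
[cite: KanekoUeda2010, §2 (chunk p4:L152–L176); §3 eq. (geo:glz) (chunk p7:L63–L110)] -/
theorem eval_coneChart_le_sum_coeff_mul_prod_pow (F : MvPolynomial (Fin N) ℝ) (hpos : ∀ c ∈ F.support, 0 ≤ F.coeff c)
    {b : Fin N →₀ ℕ} (hb : b ∈ F.support) (v : Fin M → Fin N → ℕ) (hdom : ∀ l, ∀ c ∈ F.support, ipair (v l) b ≤ ipair (v l) c)
    {z : Fin M → ℝ} (hz0 : ∀ l, 0 ≤ z l) (hz1 : ∀ l, z l ≤ 1) :
    eval (coneChart v z) F ≤ (∑ c ∈ F.support, F.coeff c) * ∏ l, z l ^ ipair (v l) b := by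
  rw [eval_coneChart_eq_monom_mul F hb v hdom z, mul_comm]
  exact mul_le_mul_of_nonneg_right (bracket_le_sum_coeff F hpos hb v hz0 hz1)
    (Finset.prod_nonneg fun l _ => pow_nonneg (hz0 l) _)

/-! ### The integrand of one leaf and the unit cube -/

/-- The leaf integrand `|P(t(z))| / Π_k F_k(t(z))^{a_k} · Π_l z_l^{w_l}` (numerator, dominated denominators, monomial weight of the
measure/Jacobian) — Borinsky's sector integrand `x^{m^{(s)}−1}·Π p^{ν}/Π q^{ρ}` with the numerator kept signed and un-factored.
[cite: Borinsky2020, §2.3 eq. (secdec_integral) (chunk p7:L8–L13)] -/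
def leafIntegrand {K : Type*} [Fintype K] (P : MvPolynomial (Fin N) ℝ) (F : K → MvPolynomial (Fin N) ℝ) (a : K → ℕ)
    (v : Fin M → Fin N → ℕ) (w : Fin M → ℕ) (z : Fin M → ℝ) : ℝ :=
  |eval (coneChart v z) P| / (∏ k, eval (coneChart v z) (F k) ^ a k) * ∏ l, z l ^ w l

/-- The half-open unit cube `(0,1]^M` of the sector variables. [cite: KanekoUeda2010, §2 «0 ≤ z_j ≤ 1» (chunk p4:L145–L146)] -/
def unitIoc (M : ℕ) : Set (Fin M → ℝ) := Set.pi Set.univ fun _ => Set.Ioc (0 : ℝ) 1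

/-- The cube is measurable. [cite: KanekoUeda2010, §2 «Integration domain of z is the (N−1)-dimensional unit cube» (chunk p4:L145–L146)] -/
theorem measurableSet_unitIoc : MeasurableSet (unitIoc M) :=
  MeasurableSet.univ_pi fun _ => measurableSet_Ioc

/-- Membership in the cube, coordinatewise. [cite: KanekoUeda2010, §2 (chunk p4:L145–L146)] -/
theorem mem_unitIoc {z : Fin M → ℝ} : z ∈ unitIoc M ↔ ∀ l, 0 < z l ∧ z l ≤ 1 := by
  simp [unitIoc, Set.mem_pi]

/-- The cube has Lebesgue measure `1`. [cite: KanekoUeda2010, §2 (chunk p4:L145–L146)] -/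
theorem volume_unitIoc : volume (unitIoc M) = 1 := by
  rw [unitIoc, Real.volume_pi_Ioc]
  simp

/-- The leaf integrand is Borel-measurable (polynomials, quotient, absolute value, monomial).
[cite: Borinsky2020, §2.3 eq. (secdec_integral) (chunk p7:L8–L13)] -/
theorem measurable_leafIntegrand {K : Type*} [Fintype K] (P : MvPolynomial (Fin N) ℝ) (F : K → MvPolynomial (Fin N) ℝ)
    (a : K → ℕ) (v : Fin M → Fin N → ℕ) (w : Fin M → ℕ) : Measurable (leafIntegrand P F a v w) := by
  unfold leafIntegrand
  refine Measurable.mul (Measurable.div (continuous_eval_coneChart P v).measurable.abs ?_) ?_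
  · exact Finset.measurable_prod _ fun k _ => (continuous_eval_coneChart (F k) v).measurable.pow_const _
  · exact Finset.measurable_prod _ fun l _ => (measurable_pi_apply l).pow_const _

/-! ### Sufficiency: `E ≥ 0` at every generator ⇒ the leaf integrand is integrable on the cube -/

section Sufficiency

variable {K : Type*} [Fintype K]

/-- **`m_k > 0` for all `k` ⇒ a bounded, hence integrable, integrand** (Borinsky §2.3; BND 5.8.1 «if E ≥ 0: bounded»): under the
hypotheses of `abs_eval_div_prod_pow_mul_monom_le` (E_l ≥ 0 at every generator) the leaf integrand is Lebesgue-integrable on `(0,1]^M`.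
[cite: Borinsky2020, §2.3 after eq. (secdec_integral): «If all components of the vector m^{(s)} are positive … produces an integral with a
bounded integrand» (chunk p7:L13–L16); KanekoUeda2010, §3 eq. (geo:glz) (chunk p7:L63–L110)] -/
theorem integrableOn_leafIntegrand_of_exponent_le (P : MvPolynomial (Fin N) ℝ) (F : K → MvPolynomial (Fin N) ℝ) (a : K → ℕ)
    (hFpos : ∀ k, ∀ c ∈ (F k).support, 0 ≤ (F k).coeff c)
    (b : K → (Fin N →₀ ℕ)) (hb : ∀ k, b k ∈ (F k).support)
    (v : Fin M → Fin N → ℕ) (w : Fin M → ℕ) (hE : ∀ l, ∑ k, a k * ipair (v l) (b k) ≤ minPair P (v l) + w l) :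
    IntegrableOn (leafIntegrand P F a v w) (unitIoc M) volume := by
  have hc : ∀ k, 0 < (F k).coeff (b k) := fun k =>
    lt_of_le_of_ne (hFpos k _ (hb k)) (Ne.symm (mem_support_iff.mp (hb k)))
  refine Measure.integrableOn_of_bounded (M := sumAbsCoeff P / ∏ k, (F k).coeff (b k) ^ a k) ?_
    (measurable_leafIntegrand P F a v w).aestronglyMeasurable ?_
  · rw [volume_unitIoc]; exact ENNReal.one_ne_top
  · filter_upwards [ae_restrict_mem measurableSet_unitIoc] with z hz
    rw [mem_unitIoc] at hz
    have hz0 : ∀ l, 0 < z l := fun l => (hz l).1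
    have hz1 : ∀ l, z l ≤ 1 := fun l => (hz l).2
    have hnn : 0 ≤ leafIntegrand P F a v w z := by
      unfold leafIntegrand
      refine mul_nonneg (div_nonneg (abs_nonneg _) (Finset.prod_nonneg fun k _ => pow_nonneg ?_ _))
        (Finset.prod_nonneg fun l _ => pow_nonneg (hz0 l).le _)
      exact (eval_eq_sum_coeff_mul_monom (coneChart v z) (F k)).symm ▸ Finset.sum_nonneg fun c hc' =>
        mul_nonneg (hFpos k c hc') (Finset.prod_nonneg fun j _ => pow_nonneg (coneChart_nonneg v (fun l => (hz0 l).le) j) _)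
    rw [Real.norm_eq_abs, abs_of_nonneg hnn]
    exact abs_eval_div_prod_pow_mul_monom_le P F a hFpos b hb hc v w hE hz0 hz1

end Sufficiency

/-! ### Necessity: one generator with `E_{l₀} ≤ −1` and a non-vanishing reduced numerator on the face ⇒ NOT integrable -/

section Divergence

variable {K : Type*} [Fintype K]

/-- A positive-coefficient polynomial is non-negative on the chart image of the closed cube. [cite: KanekoUeda2010, §2 (chunk p4:L145–L176)] -/
theorem eval_coneChart_nonneg (F : MvPolynomial (Fin N) ℝ) (hpos : ∀ c ∈ F.support, 0 ≤ F.coeff c) (v : Fin M → Fin N → ℕ)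
    {z : Fin M → ℝ} (hz0 : ∀ l, 0 ≤ z l) : 0 ≤ eval (coneChart v z) F := by
  rw [eval_eq_sum_coeff_mul_monom]
  exact Finset.sum_nonneg fun c hc => mul_nonneg (hpos c hc) (Finset.prod_nonneg fun j _ => pow_nonneg (coneChart_nonneg v hz0 j) _)

/-- The leaf integrand is non-negative on the closed cube. [cite: Borinsky2020, §2.3 eq. (secdec_integral) (chunk p7:L8–L13)] -/
theorem leafIntegrand_nonneg (P : MvPolynomial (Fin N) ℝ) (F : K → MvPolynomial (Fin N) ℝ) (a : K → ℕ)
    (hFpos : ∀ k, ∀ c ∈ (F k).support, 0 ≤ (F k).coeff c) (v : Fin M → Fin N → ℕ) (w : Fin M → ℕ)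
    {z : Fin M → ℝ} (hz0 : ∀ l, 0 ≤ z l) : 0 ≤ leafIntegrand P F a v w z :=
  mul_nonneg (div_nonneg (abs_nonneg _) (Finset.prod_nonneg fun k _ => pow_nonneg (eval_coneChart_nonneg (F k) (hFpos k) v hz0) _))
    (Finset.prod_nonneg fun l _ => pow_nonneg (hz0 l) _)

/-- The product of the dominated denominators is dominated by its monomial: `Π_k F_k(t(z))^{a_k} ≤ C_F · Π_l z_l^{S_l}` on the closed cube,
`C_F = Π_k F_k(1,…,1)^{a_k}`, `S_l = Σ_k a_k (b_k, v_l)`. [cite: KanekoUeda2010, §3 eq. (geo:glz): the exponent «(ν' + γb + βb', v_j)» (chunk p7:L63–L80)] -/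
theorem prod_eval_coneChart_pow_le (F : K → MvPolynomial (Fin N) ℝ) (a : K → ℕ)
    (hFpos : ∀ k, ∀ c ∈ (F k).support, 0 ≤ (F k).coeff c)
    (b : K → (Fin N →₀ ℕ)) (hb : ∀ k, b k ∈ (F k).support)
    (v : Fin M → Fin N → ℕ) (hdom : ∀ k l, ∀ c ∈ (F k).support, ipair (v l) (b k) ≤ ipair (v l) c)
    {z : Fin M → ℝ} (hz0 : ∀ l, 0 ≤ z l) (hz1 : ∀ l, z l ≤ 1) :
    ∏ k, eval (coneChart v z) (F k) ^ a k ≤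
      (∏ k, (∑ c ∈ (F k).support, (F k).coeff c) ^ a k) * ∏ l, z l ^ ∑ k, a k * ipair (v l) (b k) := by
  rw [← prod_mul_prod_pow_pow (fun k => ∑ c ∈ (F k).support, (F k).coeff c) (fun k l => ipair (v l) (b k)) a z]
  exact Finset.prod_le_prod (fun k _ => pow_nonneg (eval_coneChart_nonneg (F k) (hFpos k) v hz0) _)
    fun k _ => pow_le_pow_left₀ (eval_coneChart_nonneg (F k) (hFpos k) v hz0)
      (eval_coneChart_le_sum_coeff_mul_prod_pow (F k) (hFpos k) (hb k) v (hdom k) hz0 hz1) _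

/-- **`m_k ≤ 0` for some `k`, numerator non-vanishing on the face ⇒ the sector integral is DIVERGENT** (Borinsky §2.3; BND 5.8.1 «if
E_l ≤ −1: |h| ≥ ε on a box {t_l ≤ τ} × B around a point of {t_l = 0} where h ≠ 0, and ∫₀^τ t^{E_l} dt = ∞»). WITNESS FORM: `P` any (signed)
polynomial, `F_k` positive-coefficient with DOMINANT support monomials `b_k` on the cone, `a_k ∈ ℕ`, weight `w`; if at the generator `l₀`
the total exponent is ≤ −1 — `val_{v_{l₀}}(P) + w_{l₀} + 1 ≤ Σ_k a_k (b_k, v_{l₀})` — and the reduced numerator `P̃` does not vanish at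
some point of the open face `{z_{l₀} = 0}` (the point `zs` with its `l₀`-coordinate set to `0`, `0 < zs < 1`), then the leaf integrand is
NOT Lebesgue-integrable on `(0,1]^M`. (Borinsky's printed hypothesis «p_{s,i}, q_{s,i} non-vanishing on the integration domain» implies
the face hypothesis; the structural version — `P ≠ 0` homogeneous and generators spanning modulo `𝟙` — is
`not_integrableOn_leafIntegrand_of_exponent_gt_of_span` below.)
[cite: Borinsky2020, §2.3 after eq. (secdec_integral): «m^{(s)}_k ≤ 0 for some sector s ∈ S. Hence, if we assume that the polynomials
p_{s,i}, q_{s,i} are non-vanishing on the integration domain, then the associated integral I_s is divergent» (chunk p7:L23);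
KanekoUeda2010, §3 eq. (geo:glz) (chunk p7:L63–L110)] -/
theorem not_integrableOn_leafIntegrand_of_exponent_gt (P : MvPolynomial (Fin N) ℝ) (F : K → MvPolynomial (Fin N) ℝ) (a : K → ℕ)
    (hFpos : ∀ k, ∀ c ∈ (F k).support, 0 ≤ (F k).coeff c)
    (b : K → (Fin N →₀ ℕ)) (hb : ∀ k, b k ∈ (F k).support)
    (v : Fin M → Fin N → ℕ) (hdom : ∀ k l, ∀ c ∈ (F k).support, ipair (v l) (b k) ≤ ipair (v l) c)
    (w : Fin M → ℕ) (l₀ : Fin M) (hE : minPair P (v l₀) + w l₀ + 1 ≤ ∑ k, a k * ipair (v l₀) (b k))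
    (zs : Fin M → ℝ) (hzs : ∀ l, 0 < zs l ∧ zs l < 1) (hface : reducedEval P v (Function.update zs l₀ 0) ≠ 0) :
    ¬ IntegrableOn (leafIntegrand P F a v w) (unitIoc M) volume := by
  classical
  -- positivity of the dominant coefficients and of the denominators' constant `C_F`
  have hc : ∀ k, 0 < (F k).coeff (b k) := fun k =>
    lt_of_le_of_ne (hFpos k _ (hb k)) (Ne.symm (mem_support_iff.mp (hb k)))
  have hsum_pos : ∀ k, 0 < ∑ c ∈ (F k).support, (F k).coeff c := fun k =>
    lt_of_lt_of_le (hc k) (Finset.single_le_sum (fun c hc' => hFpos k c hc') (hb k))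
  set CF : ℝ := ∏ k, (∑ c ∈ (F k).support, (F k).coeff c) ^ a k with hCF
  have hCFpos : 0 < CF := Finset.prod_pos fun k _ => pow_pos (hsum_pos k) _
  -- continuity of `P̃` at the face point
  set pstar : Fin M → ℝ := Function.update zs l₀ 0 with hpstar
  set q : ℝ := reducedEval P v pstar with hq
  have hqpos : 0 < |q| := abs_pos.mpr hface
  obtain ⟨δ₀, hδ₀pos, hδ₀⟩ :=
    Metric.continuousAt_iff.mp ((continuous_reducedEval P v).continuousAt (x := pstar)) (|q| / 2) (half_pos hqpos)
  -- a margin `r` with `r ≤ zs l` and `r ≤ 1 - zs l`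
  have hMne : (Finset.univ : Finset (Fin M)).Nonempty := ⟨l₀, Finset.mem_univ _⟩
  set r : ℝ := Finset.univ.inf' hMne (fun l => min (zs l) (1 - zs l)) with hr
  have hr_le : ∀ l, r ≤ zs l ∧ r ≤ 1 - zs l := fun l => by
    have h := Finset.inf'_le (fun l => min (zs l) (1 - zs l)) (Finset.mem_univ l)
    exact ⟨h.trans (min_le_left _ _), h.trans (min_le_right _ _)⟩
  have hrpos : 0 < r := by
    rw [hr, Finset.lt_inf'_iff]
    exact fun l _ => lt_min (hzs l).1 (by linarith [(hzs l).2])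
  -- the box `B = Π_l (u_l, vv_l]`
  set η : ℝ := min (δ₀ / 2) (r / 2) with hη
  have hηpos : 0 < η := lt_min (half_pos hδ₀pos) (half_pos hrpos)
  have hηδ : η ≤ δ₀ / 2 := min_le_left _ _
  have hηr : η ≤ r / 2 := min_le_right _ _
  set u : Fin M → ℝ := fun l => if l = l₀ then 0 else zs l - η with hu
  set vv : Fin M → ℝ := fun l => if l = l₀ then η else zs l + η with hvv
  have hu0 : ∀ l, 0 ≤ u l := by
    intro l; by_cases h : l = l₀
    · simp [hu, h]
    · simp only [hu, h, if_false]; linarith [(hr_le l).1]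
  have huv : ∀ l, u l < vv l := by
    intro l; by_cases h : l = l₀
    · simp [hu, hvv, h, hηpos]
    · simp only [hu, hvv, h, if_false]; linarith
  have hv1 : ∀ l, vv l ≤ 1 := by
    intro l; by_cases h : l = l₀
    · simp only [hvv, h, if_true]; linarith [(hr_le l₀).1, (hr_le l₀).2]
    · simp only [hvv, h, if_false]; linarith [(hr_le l).2]
  have hul₀ : u l₀ = 0 := by simp [hu]
  -- exponents: `S_l`, `m_l`, and the box-lemma exponent vector `ex` (`ex_{l₀} − 1 = m + w − S ≤ −1`, `ex_l − 1 = 0` otherwise)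
  set S : Fin M → ℕ := fun l => ∑ k, a k * ipair (v l) (b k) with hS
  set m : Fin M → ℕ := fun l => minPair P (v l) with hm
  set ex : Fin M → ℝ := fun l => if l = l₀ then ((m l₀ : ℝ) + w l₀ - S l₀) + 1 else 1 with hex
  have hE' : (m l₀ : ℝ) + w l₀ + 1 ≤ S l₀ := by
    have := hE; simp only [hm, hS]; exact_mod_cast this
  have hex₀ : ex l₀ ≤ 0 := by
    simp only [hex, if_true]; linarith
  -- the constant
  set A : ℝ := ∏ l ∈ Finset.univ.erase l₀, (r / 2) ^ (m l + w l) with hA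
  have hApos : 0 < A := Finset.prod_pos fun l _ => pow_pos (half_pos hrpos) _
  set κ : ℝ := |q| / 2 / CF * A with hκ
  have hκpos : 0 < κ := mul_pos (div_pos (half_pos hqpos) hCFpos) hApos
  -- reduce to the box lemma of `Volkov2017/DominatedToyDivergence`
  intro hint
  have hint' : Integrable (leafIntegrand P F a v w) (Volkov2017.cube M) := by
    rw [Volkov2017.cube_eq_restrict]; exact hint
  refine Volkov2017.not_integrable_of_prod_rpow_le_on_box hκpos u vv hu0 huv hv1 l₀ hex₀ hul₀ ?_ hint'
  -- the lower bound `κ · z_{l₀}^{m+w−S} ≤ leafIntegrand z` on the box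
  intro z hz
  have hzpos : ∀ l, 0 < z l := fun l => (hu0 l).trans_lt (hz l).1
  have hz0 : ∀ l, 0 ≤ z l := fun l => (hzpos l).le
  have hz1 : ∀ l, z l ≤ 1 := fun l => (hz l).2.trans (hv1 l)
  have hzl₀ : z l₀ ≤ η := by have := (hz l₀).2; simpa [hvv] using this
  have hzne : ∀ l, l ≠ l₀ → zs l - η < z l ∧ z l ≤ zs l + η := fun l hl => by
    have h1 := (hz l).1; have h2 := (hz l).2
    simp only [hu, hvv, hl, if_false] at h1 h2
    exact ⟨h1, h2⟩
  have hzlow : ∀ l, l ≠ l₀ → r / 2 ≤ z l := fun l hl => by linarith [(hzne l hl).1, (hr_le l).1]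
  -- distance to the face point
  have hdist : dist z pstar < δ₀ := by
    rw [dist_pi_lt_iff hδ₀pos]
    intro l
    by_cases hl : l = l₀
    · subst hl
      rw [hpstar, Function.update_self, Real.dist_eq, sub_zero, abs_of_pos (hzpos l)]
      linarith
    · rw [hpstar, Function.update_of_ne hl, Real.dist_eq, abs_lt]
      constructor <;> linarith [(hzne l hl).1, (hzne l hl).2]
  have hR : |q| / 2 ≤ |reducedEval P v z| := by
    have h := hδ₀ hdist
    rw [Real.dist_eq] at h
    have := abs_sub_abs_le_abs_sub q (reducedEval P v z)
    rw [abs_sub_comm] at this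
    linarith
  -- numerator from below, denominator from above
  have hnum : (∏ l, z l ^ m l) * (|q| / 2) ≤ |eval (coneChart v z) P| := by
    rw [eval_coneChart_eq_prod_pow_mul_reducedEval, abs_mul, abs_of_nonneg (Finset.prod_nonneg fun l _ => pow_nonneg (hz0 l) _)]
    exact mul_le_mul_of_nonneg_left hR (Finset.prod_nonneg fun l _ => pow_nonneg (hz0 l) _)
  have hden : ∏ k, eval (coneChart v z) (F k) ^ a k ≤ CF * ∏ l, z l ^ S l :=
    prod_eval_coneChart_pow_le F a hFpos b hb v hdom hz0 hz1
  have hdenpos : 0 < ∏ k, eval (coneChart v z) (F k) ^ a k :=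
    Finset.prod_pos fun k _ => pow_pos (lt_of_lt_of_le
      (mul_pos (hc k) (Finset.prod_pos fun l _ => pow_pos (hzpos l) _))
      (coeff_mul_prod_pow_le_eval_coneChart (F k) (hFpos k) (hb k) v hz0)) _
  have hZm : 0 < ∏ l, z l ^ m l := Finset.prod_pos fun l _ => pow_pos (hzpos l) _
  have hZS : 0 < ∏ l, z l ^ S l := Finset.prod_pos fun l _ => pow_pos (hzpos l) _
  have hZw : 0 < ∏ l, z l ^ w l := Finset.prod_pos fun l _ => pow_pos (hzpos l) _
  -- the integrand dominates `(|q|/2/CF) · Π_l z^{m+w}/z^{S}`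
  have hmain : |q| / 2 / CF * ∏ l, z l ^ (m l + w l) / z l ^ S l ≤ leafIntegrand P F a v w z := by
    have hsplit : ∏ l, z l ^ (m l + w l) / z l ^ S l = (∏ l, z l ^ m l) * (∏ l, z l ^ w l) / ∏ l, z l ^ S l := by
      rw [Finset.prod_div_distrib, ← Finset.prod_mul_distrib]
      exact congrArg (· / _) (Finset.prod_congr rfl fun l _ => pow_add _ _ _)
    rw [hsplit]
    unfold leafIntegrand
    calc |q| / 2 / CF * ((∏ l, z l ^ m l) * (∏ l, z l ^ w l) / ∏ l, z l ^ S l)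
        = (∏ l, z l ^ m l) * (|q| / 2) / (CF * ∏ l, z l ^ S l) * ∏ l, z l ^ w l := by
          field_simp
      _ ≤ |eval (coneChart v z) P| / (CF * ∏ l, z l ^ S l) * ∏ l, z l ^ w l :=
          mul_le_mul_of_nonneg_right (div_le_div_of_nonneg_right hnum (mul_pos hCFpos hZS).le) hZw.le
      _ ≤ |eval (coneChart v z) P| / (∏ k, eval (coneChart v z) (F k) ^ a k) * ∏ l, z l ^ w l :=
          mul_le_mul_of_nonneg_right (div_le_div_of_nonneg_left (abs_nonneg _) hdenpos hden) hZw.le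
  -- split off the `l₀` factor
  have hfac : ∀ l, l ≠ l₀ → (r / 2) ^ (m l + w l) ≤ z l ^ (m l + w l) / z l ^ S l := fun l hl =>
    calc (r / 2) ^ (m l + w l) ≤ z l ^ (m l + w l) := pow_le_pow_left₀ (half_pos hrpos).le (hzlow l hl) _
      _ ≤ z l ^ (m l + w l) / z l ^ S l := by
          rw [le_div_iff₀ (pow_pos (hzpos l) _)]
          exact mul_le_of_le_one_right (pow_nonneg (hz0 l) _) (pow_le_one₀ (hz0 l) (hz1 l))
  have hAle : A ≤ ∏ l ∈ Finset.univ.erase l₀, z l ^ (m l + w l) / z l ^ S l :=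
    Finset.prod_le_prod (fun l _ => pow_nonneg (half_pos hrpos).le _) fun l hl => hfac l (Finset.ne_of_mem_erase hl)
  have hl₀fac : z l₀ ^ (ex l₀ - 1) = z l₀ ^ (m l₀ + w l₀) / z l₀ ^ S l₀ := by
    simp only [hex, if_true, add_sub_cancel_right]
    rw [Real.rpow_sub (hzpos l₀), ← Nat.cast_add, Real.rpow_natCast, Real.rpow_natCast]
  have hprod_ex : ∏ j, z j ^ (ex j - 1) = z l₀ ^ (ex l₀ - 1) := by
    rw [← Finset.mul_prod_erase Finset.univ (fun j => z j ^ (ex j - 1)) (Finset.mem_univ l₀)]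
    rw [Finset.prod_eq_one fun j hj => ?_, mul_one]
    simp only [hex, Finset.ne_of_mem_erase hj, if_false, sub_self, Real.rpow_zero]
  rw [abs_of_nonneg (leafIntegrand_nonneg P F a hFpos v w hz0), hprod_ex, hl₀fac]
  calc κ * (z l₀ ^ (m l₀ + w l₀) / z l₀ ^ S l₀)
      = |q| / 2 / CF * ((z l₀ ^ (m l₀ + w l₀) / z l₀ ^ S l₀) * A) := by rw [hκ]; ring
    _ ≤ |q| / 2 / CF * ((z l₀ ^ (m l₀ + w l₀) / z l₀ ^ S l₀) * ∏ l ∈ Finset.univ.erase l₀, z l ^ (m l + w l) / z l ^ S l) :=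
        mul_le_mul_of_nonneg_left (mul_le_mul_of_nonneg_left hAle (div_nonneg (pow_nonneg (hz0 l₀) _) (pow_nonneg (hz0 l₀) _)))
          (div_pos (half_pos hqpos) hCFpos).le
    _ = |q| / 2 / CF * ∏ l, z l ^ (m l + w l) / z l ^ S l := by
        rw [Finset.mul_prod_erase Finset.univ (fun l => z l ^ (m l + w l) / z l ^ S l) (Finset.mem_univ l₀)]
    _ ≤ leafIntegrand P F a v w z := hmain

end Divergence

/-! ### BND 5.8.1's remark: the face numerator is NOT the zero polynomial (homogeneous `P`, generators spanning modulo `𝟙`) -/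

section NonCancellation

/-- The pairing over the whole index set: `(c, v_k) = Σ_j (v_k)_j c_j`. [cite: KanekoUeda2010, §3 (chunk p6:L50–L56)] -/
theorem ipair_eq_sum_univ (w : Fin N → ℕ) (c : Fin N →₀ ℕ) : ipair w c = ∑ j, w j * c j := by
  unfold ipair
  exact Finset.sum_subset (Finset.subset_univ _) fun j _ hj => by rw [Finsupp.notMem_support_iff.mp hj, mul_zero]

/-- Homogeneity read on the support: every monomial of `P` has total degree `n`. [folklore] -/
private theorem sum_eq_of_isHomogeneous {p : MvPolynomial (Fin N) ℝ} {n : ℕ} (hhom : p.IsHomogeneous n) {c : Fin N →₀ ℕ}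
    (hc : c ∈ p.support) : ∑ j, c j = n := by
  have h := hhom (mem_support_iff.mp hc)
  rw [← Finsupp.degree_eq_sum, Finsupp.degree_eq_weight_one]
  exact h

/-- **Injectivity of the exponent map** (BND 5.8.1's remark «the monomials of P … map injectively to t-exponent vectors (v_1..v_M and 1_E
span ℝ^N; P is homogeneous)»): if the only vector `d` with `(v_l, d) = 0` for all generators and `Σ d = 0` is `d = 0` (the generators
together with `𝟙` span `ℝ^N`), then on the support of a HOMOGENEOUS `P` the map `c ↦ ((c, v_l))_l` is injective — linear algebra on the
printed chart «t_j = Π_k z_k^{(v_k)_j}»; the remark itself is the cell theory seat's, KU print the positive-coefficient case where no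
cancellation can arise. [cite: KanekoUeda2010, §3 after eq. (geo:glz) (chunk p7:L95–L110)] -/
theorem injOn_ipair_of_span (p : MvPolynomial (Fin N) ℝ) {n : ℕ} (hhom : p.IsHomogeneous n) (v : Fin M → Fin N → ℕ)
    (hspan : ∀ d : Fin N → ℝ, (∀ l, ∑ j, (v l j : ℝ) * d j = 0) → ∑ j, d j = 0 → d = 0) :
    Set.InjOn (fun c : Fin N →₀ ℕ => fun l => ipair (v l) c) p.support := by
  intro c hc c' hc' h
  have hd := hspan (fun j => (c j : ℝ) - c' j) (fun l => by
      have hl : ipair (v l) c = ipair (v l) c' := congrFun h l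
      rw [ipair_eq_sum_univ, ipair_eq_sum_univ] at hl
      have hl' : (∑ j, (v l j : ℝ) * c j) = ∑ j, (v l j : ℝ) * c' j := by exact_mod_cast hl
      simp only [mul_sub, Finset.sum_sub_distrib, hl', sub_self])
    (by
      have h1 : (∑ j, (c j : ℝ)) = n := by exact_mod_cast sum_eq_of_isHomogeneous hhom hc
      have h2 : (∑ j, (c' j : ℝ)) = n := by exact_mod_cast sum_eq_of_isHomogeneous hhom hc'
      rw [Finset.sum_sub_distrib, h1, h2, sub_self])
  ext j
  have hj := congrFun hd j
  simp only [Pi.zero_apply, sub_eq_zero] at hj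
  exact_mod_cast hj

/-- The reduced exponent vector of a monomial in the sector variables: `e(c)_l = (c, v_l) − val_{v_l}(P) ∈ ℕ`.
[cite: KanekoUeda2010, §3 after eq. (geo:glz): «(c−b, v_j) is non-negative integer» (chunk p7:L100–L110)] -/
def redExp (p : MvPolynomial (Fin N) ℝ) (v : Fin M → Fin N → ℕ) (c : Fin N →₀ ℕ) : Fin M →₀ ℕ :=
  Finsupp.equivFunOnFinite.symm fun l => ipair (v l) c - minPair p (v l)

/-- Components of the reduced exponent vector. [cite: KanekoUeda2010, §3 after eq. (geo:glz) (chunk p7:L100–L110)] -/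
@[simp] theorem redExp_apply (p : MvPolynomial (Fin N) ℝ) (v : Fin M → Fin N → ℕ) (c : Fin N →₀ ℕ) (l : Fin M) :
    redExp p v c l = ipair (v l) c - minPair p (v l) := by
  simp [redExp]

/-- The FACE POLYNOMIAL at the generator `l₀`: the part of `P̃` surviving on `{z_{l₀} = 0}`, i.e. the monomials of `P` attaining
`val_{v_{l₀}}(P)`, as a polynomial in the sector variables (BND 5.8.1's `P̃|_{t_l = 0}`).
[cite: KanekoUeda2010, §3 «the dominant term of P(t) in this limit» (chunk p6:L50–L60); eq. (geo:glz) (chunk p7:L63–L110)] -/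
def facePoly (p : MvPolynomial (Fin N) ℝ) (v : Fin M → Fin N → ℕ) (l₀ : Fin M) : MvPolynomial (Fin M) ℝ :=
  ∑ c ∈ p.support.filter (fun c => ipair (v l₀) c = minPair p (v l₀)), monomial (redExp p v c) (p.coeff c)

/-- The face polynomial evaluates to `P̃` on the face: `facePoly(z) = P̃(z with z_{l₀} := 0)`.
[cite: KanekoUeda2010, §3 eq. (geo:glz) (chunk p7:L63–L110)] -/
theorem eval_facePoly (p : MvPolynomial (Fin N) ℝ) (v : Fin M → Fin N → ℕ) (l₀ : Fin M) (z : Fin M → ℝ) :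
    eval z (facePoly p v l₀) = reducedEval p v (Function.update z l₀ 0) := by
  classical
  have key : ∀ c ∈ p.support, p.coeff c * ∏ l, Function.update z l₀ 0 l ^ (ipair (v l) c - minPair p (v l)) =
      if ipair (v l₀) c = minPair p (v l₀) then p.coeff c * ∏ l, z l ^ (ipair (v l) c - minPair p (v l)) else 0 := by
    intro c hc
    rw [← Finset.mul_prod_erase Finset.univ (fun l => Function.update z l₀ 0 l ^ (ipair (v l) c - minPair p (v l)))
      (Finset.mem_univ l₀), Function.update_self,
      ← Finset.mul_prod_erase Finset.univ (fun l => z l ^ (ipair (v l) c - minPair p (v l))) (Finset.mem_univ l₀)]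
    have herase : ∏ l ∈ Finset.univ.erase l₀, Function.update z l₀ 0 l ^ (ipair (v l) c - minPair p (v l)) =
        ∏ l ∈ Finset.univ.erase l₀, z l ^ (ipair (v l) c - minPair p (v l)) :=
      Finset.prod_congr rfl fun l hl => by rw [Function.update_of_ne (Finset.ne_of_mem_erase hl)]
    rw [herase]
    split_ifs with h
    · rw [h, Nat.sub_self, pow_zero, pow_zero]
    · have hpos : 0 < ipair (v l₀) c - minPair p (v l₀) := Nat.sub_pos_of_lt (lt_of_le_of_ne (minPair_le hc) (Ne.symm h))
      rw [zero_pow hpos.ne', zero_mul, mul_zero]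
  rw [reducedEval, Finset.sum_congr rfl key, ← Finset.sum_filter, facePoly, map_sum]
  refine Finset.sum_congr rfl fun c _ => ?_
  rw [eval_monomial, Finsupp.prod_fintype _ _ (fun l => pow_zero _)]
  simp only [redExp_apply]

/-- **The face polynomial is not zero** (BND 5.8.1's remark «P̃|_{t_l=0} is NOT the zero polynomial … so no cancellation can occur among
them»): for `P ≠ 0` and the exponent map injective on `supp P`, the coefficient of `facePoly` at the reduced exponent of a monomial
attaining `val_{v_{l₀}}(P)` is that monomial's coefficient (KU print the positive-coefficient case «the behavior of P in the limit … is
determined by the term a_b e^{−(b,y)}», where no cancellation can arise). [cite: KanekoUeda2010, §3 (chunk p6:L57–L70); after eq. (geo:glz) (chunk p7:L100–L110)] -/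
theorem facePoly_ne_zero (p : MvPolynomial (Fin N) ℝ) (hp : p ≠ 0) (v : Fin M → Fin N → ℕ) (l₀ : Fin M)
    (hinj : Set.InjOn (fun c : Fin N →₀ ℕ => fun l => ipair (v l) c) p.support) : facePoly p v l₀ ≠ 0 := by
  classical
  obtain ⟨c₀, hc₀, hmin⟩ := exists_ipair_eq_minPair hp (v l₀)
  have hcoeff : (facePoly p v l₀).coeff (redExp p v c₀) = p.coeff c₀ := by
    rw [facePoly, coeff_sum]
    simp_rw [coeff_monomial]
    rw [Finset.sum_eq_single c₀]
    · rw [if_pos rfl]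
    · intro c hc hne
      rw [if_neg]
      intro heq
      apply hne
      have hc' : c ∈ p.support := (Finset.mem_filter.mp hc).1
      refine hinj hc' hc₀ (funext fun l => ?_)
      have hl := congrArg (fun e : Fin M →₀ ℕ => e l) heq
      simp only [redExp_apply] at hl
      have h1 := minPair_le (w := v l) hc'
      have h2 := minPair_le (w := v l) hc₀
      dsimp only
      omega
    · intro h
      exact absurd (Finset.mem_filter.mpr ⟨hc₀, hmin⟩) h
  intro hzero
  rw [hzero, coeff_zero] at hcoeff
  exact (mem_support_iff.mp hc₀) hcoeff.symm

/-- **A witness on the open face exists**: a non-zero polynomial over `ℝ` cannot vanish on the box `(0,1)^M` (Mathlib's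
`MvPolynomial.funext_set`), so `P̃` is non-zero at some point of the open face `{z_{l₀} = 0, 0 < z_l < 1}` — this supplies Borinsky's
hypothesis «p_{s,i} … non-vanishing» at one point of the face, which is all the divergence argument uses.
[cite: Borinsky2020, §2.3 (chunk p7:L23); KanekoUeda2010, §3 (chunk p6:L57–L70)] -/
theorem exists_reducedEval_face_ne_zero (p : MvPolynomial (Fin N) ℝ) (hp : p ≠ 0) (v : Fin M → Fin N → ℕ) (l₀ : Fin M)
    (hinj : Set.InjOn (fun c : Fin N →₀ ℕ => fun l => ipair (v l) c) p.support) :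
    ∃ zs : Fin M → ℝ, (∀ l, 0 < zs l ∧ zs l < 1) ∧ reducedEval p v (Function.update zs l₀ 0) ≠ 0 := by
  classical
  by_contra h
  push Not at h
  apply facePoly_ne_zero p hp v l₀ hinj
  refine MvPolynomial.funext_set (fun _ : Fin M => Set.Ioo (0 : ℝ) 1) (fun _ => Set.Ioo_infinite zero_lt_one) fun z hz => ?_
  rw [map_zero, eval_facePoly]
  exact h z fun l => hz l (Set.mem_univ l)

end NonCancellation

/-! ### BND 5.8.1, both halves: on a dominated leaf, `f·J ∈ L¹(cube) ⟺ E ≥ 0 at every generator` -/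

section Criterion

variable {K : Type*} [Fintype K]

/-- **Divergence, structural form** (BND 5.8.1 «if E_l ≤ −1 … ∫₀^τ t^{E_l} dt = ∞»): `P ≠ 0` homogeneous, generators `v_l` spanning
`ℝ^N` together with `𝟙`, positive-coefficient `F_k` dominated by `b_k` on the cone, and ONE generator `l₀` with total exponent `≤ −1`
⇒ the leaf integrand is not integrable on `(0,1]^M`.
[cite: Borinsky2020, §2.3 (chunk p7:L23: «m^{(s)}_k ≤ 0 … the associated integral I_s is divergent»); KanekoUeda2010, §3 eq. (geo:glz) (chunk p7:L63–L110)] -/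
theorem not_integrableOn_leafIntegrand_of_exponent_gt_of_span (P : MvPolynomial (Fin N) ℝ) (hP : P ≠ 0) {n : ℕ}
    (hhom : P.IsHomogeneous n) (F : K → MvPolynomial (Fin N) ℝ) (a : K → ℕ)
    (hFpos : ∀ k, ∀ c ∈ (F k).support, 0 ≤ (F k).coeff c)
    (b : K → (Fin N →₀ ℕ)) (hb : ∀ k, b k ∈ (F k).support)
    (v : Fin M → Fin N → ℕ) (hdom : ∀ k l, ∀ c ∈ (F k).support, ipair (v l) (b k) ≤ ipair (v l) c)
    (hspan : ∀ d : Fin N → ℝ, (∀ l, ∑ j, (v l j : ℝ) * d j = 0) → ∑ j, d j = 0 → d = 0)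
    (w : Fin M → ℕ) (l₀ : Fin M) (hE : minPair P (v l₀) + w l₀ + 1 ≤ ∑ k, a k * ipair (v l₀) (b k)) :
    ¬ IntegrableOn (leafIntegrand P F a v w) (unitIoc M) volume := by
  obtain ⟨zs, hzs, hface⟩ := exists_reducedEval_face_ne_zero P hP v l₀ (injOn_ipair_of_span P hhom v hspan)
  exact not_integrableOn_leafIntegrand_of_exponent_gt P F a hFpos b hb v hdom w l₀ hE zs hzs hface

/-- **BND 5.8.1 / Borinsky §2.3, the criterion on one dominated leaf**: under the structural hypotheses (`P ≠ 0` homogeneous,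
generators spanning modulo `𝟙`, positive-coefficient denominators dominated on the cone) the leaf integrand
`|P(t(z))|/Π F_k(t(z))^{a_k}·Π z_l^{w_l}` is Lebesgue-integrable on `(0,1]^M` IF AND ONLY IF at every generator
`Σ_k a_k (b_k, v_l) ≤ val_{v_l}(P) + w_l` (BND: `E_l ≥ 0`; Borinsky: `m_k > 0`).
[cite: Borinsky2020, §2.3 after eq. (secdec_integral) (chunk p7:L13–L23); KanekoUeda2010, §3 eq. (geo:glz) (chunk p7:L63–L110)] -/
theorem integrableOn_leafIntegrand_iff_of_span (P : MvPolynomial (Fin N) ℝ) (hP : P ≠ 0) {n : ℕ}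
    (hhom : P.IsHomogeneous n) (F : K → MvPolynomial (Fin N) ℝ) (a : K → ℕ)
    (hFpos : ∀ k, ∀ c ∈ (F k).support, 0 ≤ (F k).coeff c)
    (b : K → (Fin N →₀ ℕ)) (hb : ∀ k, b k ∈ (F k).support)
    (v : Fin M → Fin N → ℕ) (hdom : ∀ k l, ∀ c ∈ (F k).support, ipair (v l) (b k) ≤ ipair (v l) c)
    (hspan : ∀ d : Fin N → ℝ, (∀ l, ∑ j, (v l j : ℝ) * d j = 0) → ∑ j, d j = 0 → d = 0)
    (w : Fin M → ℕ) :
    IntegrableOn (leafIntegrand P F a v w) (unitIoc M) volume ↔ ∀ l, ∑ k, a k * ipair (v l) (b k) ≤ minPair P (v l) + w l := by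
  refine ⟨fun h l => ?_, integrableOn_leafIntegrand_of_exponent_le P F a hFpos b hb v w⟩
  by_contra hlt
  exact not_integrableOn_leafIntegrand_of_exponent_gt_of_span P hP hhom F a hFpos b hb v hdom hspan w l (by omega) h

end Criterion

end Literature.MathematicalPhysics.QuantumFieldTheory.KanekoUeda2010
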